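import Literature.NumberTheory.PAdicHodge.BmaxPlusTransportedLegendre
import Literature.NumberTheory.PAdicHodge.BdRPlusEmbedding
import Literature.NumberTheory.EllipticCurves.HasseInvariantTraceProofs
import HarnessLib

/-!
# `hne` for the cells' Hodge pair in the branch `B ≠ 0`, CONDITIONAL on Fontaine's injectivity `F ⊗_{F₀} B_cris → B_dR`

Topic `Literature/NumberTheory/PAdicHodge` (theorems + ONE inline named fact; no instance, no `sorry`). Sequel of `BmaxPlusTransportedLegendre`
(`hne ⟸ D ≢ 0`, the branch `B = 0`) and `BmaxPlusTransportedPeriodNondegenerate`. The socket's hypothesis `hne : Pω″ ≢ 0` for the transported Hodge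
pair `Pω″ = A·P⁰ + B·Q⁰` (`A = Σ aᵢϖⁱ`, `B = Σ bᵢϖⁱ`, `aᵢ, bᵢ ∈ ℚ_p`, `P⁰ = f∘LT`, `Q⁰ = f∘φ∘LT`) is NOT a consequence of Kummer data; in the branch
`B ≠ 0` it is the `F`-linear independence of the two crystalline periods `fΛ, fφΛ` in `B_dR⁺`, i.e. an instance of Fontaine's theorem that
`K ⊗_{K₀} B_cris → B_dR` is injective (Brinon–Conrad Thm. 9.1.5; Fontaine's own argument is incomplete for `e(K) > 1`, loc. cit.). Here:

* `frob_bmaxPlus_eisenstein_independent` — the NAMED FACT (special case of Brinon–Conrad Thm. 9.1.5 with Colmez's `φ(A_max) ⊂ A_cris`): a relation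
  `Σ_{i<e} ι_F(ϖ)ⁱ·f(φ bᵢ) = 0` in `B_dR⁺` with `bᵢ ∈ A_max` forces every `φ bᵢ = 0` (`1, ϖ, …, ϖ^{e−1}` are linearly independent over `F₀` because
  `D.poly` is Eisenstein over `W(k_F)` as well).
* `hasseManinTr_eq_zero_of_hasseCoeff_eq_zero` — `a_p = 0` for a supersingular curve over `𝔽_p`, `p ≥ 5` (Hasse's bound `a_p² ≤ 4p` and `p ∣ a_p`).
* `eq_zero_of_zpToAinf_mul_eq_zero` — non-zero `ℤ_p`-scalars are non-zero-divisors on `A_max`.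
* ★★ `transported_hodgePair_apply_ne_zero_of_independent` — GRANTED the named fact: for `E₀/ℤ` good supersingular at `p ≥ 5`, `W_D ≡ E₀ (mod ϖ)`, integral
  coefficient vectors `a, b : Fin e → ℤ_p` not both zero, and EVERY `τ ≠ 0` in `T_pŴ_D`:
  **`Σᵢ ι_F(ϖ)ⁱ·(aᵢ·P⁰τ + bᵢ·Q⁰τ) ≠ 0`** (so `hne`, indeed injectivity, of `Pω″`). Proof: the relation is `Σ ϖⁱ f(φ b′ᵢ)` with
  `b′ᵢ = −aᵢφΛ + p bᵢΛ` (`φ²Λ = −pΛ`, Honda with `a_p = 0`); the fact gives `aᵢΛ + bᵢφΛ = 0` for all `i`, whence `(aᵢ² + p bᵢ²)·Λ = 0`, `Λ = 0`,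
  contradicting non-degeneracy (`θ(Λ) = 0 = θ(φΛ)` is impossible for `τ ≠ 0`).

Purpose (line `kato_lever`, crux K★ `stmt-BirchSwinnertonDyer-22226`, memo `Lines/kato-lever-K2-transported-period-hom.md` §3): isolates the LAST non-plumbing
input of (K₂)@K★-cells as one classical theorem of `p`-adic Hodge theory. Everything here is CONDITIONAL on that named fact; BSD / K★ are NOT proved by
any of this; nothing about elliptic curves over number fields is proved here.

## References
* O. Brinon, B. Conrad, *CMI Summer School notes on p-adic Hodge theory* (2009), Thm. 9.1.5, Prop. 9.1.6. [BrinonConrad2009]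
* P. Colmez, *Théorie d'Iwasawa des représentations de de Rham d'un corps local*, Ann. of Math. 148 (1998), §III.2. [Colmez1998Annals]
* J.-M. Fontaine, *Le corps des périodes p-adiques*, Astérisque 223 (1994), Exp. II §4.1, Exp. III Th. 5.3.7. [FontaineAsterisque223III]
* J. H. Silverman, *The Arithmetic of Elliptic Curves* (2009), Thm. V.1.1, Thm. V.4.1(a), Ex. 5.10. [SilvermanAEC2009]
-/

noncomputable section

open Ideal WittVector ValuativeRel Field
open scoped Classical

namespace Literature.NumberTheory.PAdicHodge

open Literature.NumberTheory.GaloisRepresentations Literature.NumberTheory.GaloisRepresentations.IsNonarchimedeanLocalField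
open Literature.NumberTheory.GaloisRepresentations.LubinTate Literature.NumberTheory.EllipticCurves
open Literature.RingTheory.FormalGroups

/-! ## §0 The named fact -/

/-- **Fontaine's injectivity `K ⊗_{K₀} B_cris → B_dR` (Brinon–Conrad Thm. 9.1.5), the special case used for the K★ cells.** For a `p`-adic field `F`,
an Eisenstein root datum `D` over `F` (`ϖ = D.root ∈ F` a root of the Eisenstein polynomial `D.poly ∈ ℤ_p[X]` of degree `e = D.e`, so
`1, ϖ, …, ϖ^{e−1}` are linearly independent over the maximal unramified subfield `F₀ ⊂ B_cris`), and `b₀, …, b_{e−1} ∈ A_max`: if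
`Σᵢ ι_F(ϖ)ⁱ · f(φ bᵢ) = 0` in `B_dR⁺`, where `f = bmaxPlusToBdR` is the comparison and `φ bᵢ ∈ φ(A_max) ⊂ A_cris ⊂ B_cris` (Colmez), then `φ bᵢ = 0`
for every `i`. -- TODO(general form): the natural `G_K`-equivariant map `K ⊗_{K₀} B_cris → B_dR` is injective (all of `B_cris`, any finite `K/K₀`).
[cite: BrinonConrad2009, Thm. 9.1.5] [cite: Colmez1998Annals, §III.2] [file NumberTheory/PAdicHodge/CrystallineDeRhamTensorInjective] -/
def frob_bmaxPlus_eisenstein_independent : Prop :=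
  ∀ {F : Type} [Field F] [ValuativeRel F] [TopologicalSpace F] [IsNonarchimedeanLocalField F] [CharZero F]
    {p : ℕ} [Fact p.Prime] [Fact (¬ IsUnit (p : integerC F))] [IsAdicComplete (Ideal.span {(p : integerC F)}) (integerC F)]
    (hp : valuation F p < 1) (hF : Function.Surjective (fontaineTheta (integerC F) p)) (D : EisensteinRoot F p hp)
    (b : Fin D.e → BmaxPlus F p),
    (∑ i : Fin D.e, embBdRHom hp hF (D.root ^ (i : ℕ)) * bmaxPlusToBdR F p (frobBmaxPlus F p (b i))) = 0 →
    ∀ i, frobBmaxPlus F p (b i) = 0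

/-! ## §1 `a_p = 0` for supersingular curves over `𝔽_p`, `p ≥ 5` -/

/-- **`a_p = 0` for a supersingular elliptic curve over `𝔽_p` when `p ≥ 5`**: `p ∣ a_p` (`hasseCoeff = 0`, AEC V.4.1(a)) and Hasse's bound
`a_p² ≤ 4p < p²` (AEC V.1.1, tree `HasseManin.abs_card_sub_le`). [cite: SilvermanAEC2009, Thm. V.1.1 and Thm. V.4.1(a)] -/
theorem hasseManinTr_eq_zero_of_hasseCoeff_eq_zero {p : ℕ} [Fact p.Prime] (hp5 : 5 ≤ p) (E : WeierstrassCurve (ZMod p)) [E.IsElliptic]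
    (hA : E.hasseCoeff p = 0) : HasseManin.tr E = 0 := by
  have hprime : p.Prime := Fact.out
  have hp2 : p ≠ 2 := by omega
  obtain ⟨m, hm⟩ := (E.hasseCoeff_eq_zero_iff_dvd_tr hp2).1 hA
  have hbound := HasseManin.abs_card_sub_le E
  have hcard : (Fintype.card (ZMod p) : ℝ) = p := by rw [ZMod.card]
  rw [hcard] at hbound
  have htr : (HasseManin.tr E : ℝ) = ((p : ℝ) + 1) - (Nat.card E.toAffine.Point : ℝ) := by
    rw [HasseManin.tr, ZMod.card]; push_cast; ring
  have habs : |(HasseManin.tr E : ℝ)| ≤ 2 * Real.sqrt p := by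
    rw [htr, abs_sub_comm]; exact hbound
  have hsq : ((HasseManin.tr E : ℝ)) ^ 2 ≤ 4 * p := by
    have h0 : 0 ≤ 2 * Real.sqrt p := by positivity
    have h1 := (sq_le_sq' (by linarith [abs_le.1 habs]) (abs_le.1 habs).2)
    calc ((HasseManin.tr E : ℝ)) ^ 2 ≤ (2 * Real.sqrt p) ^ 2 := h1
      _ = 4 * p := by rw [mul_pow, Real.sq_sqrt (by positivity)]; ring
  have hsqZ : (HasseManin.tr E) ^ 2 ≤ 4 * p := by exact_mod_cast hsq
  by_contra hne
  have hm0 : m ≠ 0 := fun h0 => hne (by rw [hm, h0, mul_zero])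
  have h1 : (1 : ℤ) ≤ m ^ 2 := by
    have := Int.one_le_abs hm0
    nlinarith [abs_nonneg m, sq_abs m]
  have h2 : (p : ℤ) ^ 2 ≤ (HasseManin.tr E) ^ 2 := by
    rw [hm, mul_pow]; nlinarith
  have h3 : (p : ℤ) ^ 2 ≤ 4 * p := h2.trans hsqZ
  have h5 : (5 : ℤ) ≤ p := by exact_mod_cast hp5
  nlinarith

/-! ## §2 `ℤ_p`-scalars on `A_max` -/

section Scalars

variable {F : Type} [Field F] [ValuativeRel F] [TopologicalSpace F] [IsNonarchimedeanLocalField F] [CharZero F]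
  {p : ℕ} [Fact p.Prime] [Fact (¬ IsUnit (p : integerC F))] [IsAdicComplete (Ideal.span {(p : integerC F)}) (integerC F)]

omit [CharZero F] [Fact (¬ IsUnit (p : integerC F))] [IsAdicComplete (Ideal.span {(p : integerC F)}) (integerC F)] [Field F]
  [ValuativeRel F] [TopologicalSpace F] [IsNonarchimedeanLocalField F] in
/-- `a² + p·b² ≠ 0` in `ℤ_p` unless `a = b = 0` (the valuations of `a²` and `p b²` have different parities). [cite: SerreLocalFields1979, Ch. II §1] -/
private theorem sq_add_prime_mul_sq_ne_zero (a b : ℤ_[p]) (h : a ≠ 0 ∨ b ≠ 0) : a ^ 2 + (p : ℤ_[p]) * b ^ 2 ≠ 0 := by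
  have hp : p.Prime := Fact.out
  intro h0
  have hb0 : b ≠ 0 := by
    intro hb
    rw [hb, zero_pow two_ne_zero, mul_zero, add_zero] at h0
    rcases h with ha | hb'
    · exact ha (pow_eq_zero_iff two_ne_zero |>.1 h0)
    · exact hb' hb
  have ha0 : a ≠ 0 := by
    intro ha
    rw [ha, zero_pow two_ne_zero, zero_add] at h0
    exact (mul_ne_zero (Nat.cast_ne_zero.2 hp.ne_zero : (p : ℤ_[p]) ≠ 0) (pow_ne_zero 2 hb0)) h0
  -- norms: `‖a‖² = ‖p‖·‖b‖²`, i.e. `p^{-2v(a)} = p^{-1-2v(b)}` — parity contradiction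
  have heq : a ^ 2 = -((p : ℤ_[p]) * b ^ 2) := eq_neg_of_add_eq_zero_left h0
  have hn := congrArg (fun x : ℤ_[p] => ‖x‖) heq
  simp only [norm_neg, norm_mul, norm_pow] at hn
  have hp1 : (1 : ℝ) < p := by exact_mod_cast hp.one_lt
  have hp0 : (0 : ℝ) < p := by positivity
  rw [PadicInt.norm_eq_zpow_neg_valuation ha0, PadicInt.norm_eq_zpow_neg_valuation hb0, PadicInt.norm_p, ← zpow_natCast, ← zpow_natCast, ← zpow_mul,
    ← zpow_mul, ← zpow_neg_one, ← zpow_add₀ hp0.ne'] at hn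
  have h := zpow_right_injective₀ hp0 hp1.ne' hn
  push_cast at h
  omega

set_option maxHeartbeats 1600000 in
/-- **Non-zero `ℤ_p`-scalars are non-zero-divisors on `A_max`** (`c = u·p^m`, `u ∈ ℤ_pˣ`; `p^m` is a non-zero-divisor,
`eq_zero_of_natCast_pow_mul_eq_zero`). [cite: Colmez1998Annals, §III.2] -/
theorem eq_zero_of_zpToAinf_mul_eq_zero (hF : Function.Surjective (fontaineTheta (integerC F) p)) {c : ℤ_[p]} (hc : c ≠ 0)
    {x : BmaxPlus F p} (h : ainfToBmaxPlus F p (zpToAinf c) * x = 0) : x = 0 := by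
  have hspec := PadicInt.unitCoeff_spec hc
  set u := PadicInt.unitCoeff hc with hu
  have h1 : (p : BmaxPlus F p) ^ c.valuation * (ainfToBmaxPlus F p (zpToAinf (u : ℤ_[p])) * x) = 0 := by
    have e : ainfToBmaxPlus F p (zpToAinf c) = ainfToBmaxPlus F p (zpToAinf (u : ℤ_[p])) * (p : BmaxPlus F p) ^ c.valuation := by
      conv_lhs => rw [hspec]
      rw [map_mul, map_mul, map_pow, map_pow, map_natCast, map_natCast]
    rw [e] at h
    linear_combination h
  have h2 := eq_zero_of_natCast_pow_mul_eq_zero hF c.valuation h1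
  have h3 : ainfToBmaxPlus F p (zpToAinf ((u⁻¹ : ℤ_[p]ˣ) : ℤ_[p])) * (ainfToBmaxPlus F p (zpToAinf (u : ℤ_[p])) * x) = 0 := by
    rw [h2, mul_zero]
  rwa [← mul_assoc, ← map_mul, ← map_mul, Units.inv_mul, map_one, map_one, one_mul] at h3

end Scalars

/-! ## §3 `hne` for the Hodge pair, branch `B ≠ 0`, conditional on the named fact -/

section Transported

variable {F : Type} [Field F] [ValuativeRel F] [TopologicalSpace F] [IsNonarchimedeanLocalField F] [CharZero F]
  {p : ℕ} [hpp : Fact p.Prime] [Fact (¬ IsUnit (p : integerC F))] [IsAdicComplete (Ideal.span {(p : integerC F)}) (integerC F)]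
  {hp : valuation F p < 1} (D : EisensteinRoot F p hp) {hθ : Function.Surjective (fontaineTheta (integerC F) p)}
  (W : WeierstrassCurve (EisensteinRoot.CoeffDisc D)) (E₀ : WeierstrassCurve ℤ)
  (hWE : W.map (Ideal.Quotient.mk (Ideal.span {EisensteinRoot.CoeffDisc.of D (AdjoinRoot.root D.poly)})) =
    (E₀.map (algebraMap ℤ (EisensteinRoot.CoeffDisc D))).map
      (Ideal.Quotient.mk (Ideal.span {EisensteinRoot.CoeffDisc.of D (AdjoinRoot.root D.poly)})))
  (ψ : EisensteinRoot.CoeffDisc D →+* LTCoeff F) (hψ : ∀ c, algebraMap (LTCoeff F) F (ψ c) = EisensteinRoot.CoeffDisc.toF D c)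

include hWE hψ in
set_option maxHeartbeats 3200000 in
/-- ★★ **`hne` (indeed injectivity) for the cells' Hodge pair, GRANTED Fontaine's injectivity.** Let `W_D ≡ E₀ (mod ϖ)` with `E₀/ℤ` of good
supersingular reduction at `p ≥ 5` (so `a_p = 0` and `φ²Λ = −pΛ` for every transported period), `LT, P⁰ = f∘LT, Q⁰ = f∘φ∘LT` the transported
period maps (through their specification, index `N ≥ e`), and `a, b : Fin e → ℤ_p` not both identically zero (the integral coordinates of the Hodge
line `A = Σ aᵢϖⁱ`, `B = Σ bᵢϖⁱ`, after clearing denominators). Then, assuming `frob_bmaxPlus_eisenstein_independent`, for EVERY `τ ≠ 0` in `T_pŴ_D`: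
**`Σᵢ ι_F(ϖ)ⁱ·(aᵢ·P⁰τ + bᵢ·Q⁰τ) ≠ 0`** in `B_dR⁺`. (With `Λ = LT τ`: the sum is `p⁻¹·Σᵢ ϖⁱ·f(φ b′ᵢ)`, `b′ᵢ = −aᵢφΛ + p bᵢΛ`; the fact gives
`aᵢΛ + bᵢφΛ = 0` for all `i`; applying `φ` and eliminating, `(aᵢ² + p bᵢ²)Λ = 0`, so `Λ = 0`, contradicting non-degeneracy.)
[cite: BrinonConrad2009, Thm. 9.1.5] [cite: Kato1993LNM1553, Ch. II §1.4] [cite: Colmez1992PeriodesAbeliennes, §2] -/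
theorem transported_hodgePair_apply_ne_zero_of_independent (hINJ : frob_bmaxPlus_eisenstein_independent) (hp5 : 5 ≤ p)
    (hΔ : ¬ (p : ℤ) ∣ E₀.Δ) (hA : (E₀.map (Int.castRingHom (ZMod p))).hasseCoeff p = 0) [(E₀.map (Int.castRingHom ℚ_[p])).IsElliptic]
    [(E₀.map (Int.castRingHom (ZMod p))).IsElliptic] [(curveOver (CompletedAlgClosure F) E₀).IsElliptic]
    {N : ℕ} (hN : D.e ≤ N) {LT : AinfTop.TatePtO F (W.map ψ) p →+ BmaxPlus F p} {P₀ Q₀ : AinfTop.TatePtO F (W.map ψ) p →+ BdRPlusTop F p}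
    (hLT : ∀ (τ : AinfTop.TatePtO F (W.map ψ) p) (w : ℕ → (maxNilIdealC F).toIdeal) (hw : ∀ n, AinfTop.mulPC F p E₀ (w (n + 1)) = w n)
        (_ : ∀ n, ‖(((w n : (maxNilIdealC F).toIdeal) : CBall F) : CompletedAlgClosure F) -
      (((AinfTop.seqO (W.map ψ) τ n : (maxNilIdealC F).toIdeal) : CBall F) : CompletedAlgClosure F)‖ ≤ ‖((D.rootC : integerC F) : CompletedAlgClosure F)‖)
        (z : bmaxZero F p), algebraMap (Ainf (p := p) F) (bmaxZero F p)
        ((AinfTop.of F p).symm (((AinfTop.divisionLiftPt E₀ hθ w hw).val : (AinfTop.nilTheta F p hθ).toIdeal) : AinfTop F p)) ^ N =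
      (p : bmaxZero F p) * z →
        LT τ = PadicLogSeries.logSum ((algebraMap (Ainf (p := p) F) (bmaxZero F p)).comp zpToAinf) (GaloisContinuity.formalLogNum E₀ p) N
          (algebraMap (Ainf (p := p) F) (bmaxZero F p)
            ((AinfTop.of F p).symm (((AinfTop.divisionLiftPt E₀ hθ w hw).val : (AinfTop.nilTheta F p hθ).toIdeal) : AinfTop F p))) z)
    (hP₀ : ∀ τ, P₀ τ = BdRPlusTop.of F p (bmaxPlusToBdR F p (LT τ)))
    (hQ₀ : ∀ τ, Q₀ τ = BdRPlusTop.of F p (bmaxPlusToBdR F p (frobBmaxPlus F p (LT τ))))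
    (a b : Fin D.e → ℤ_[p]) (hab : ∃ i, a i ≠ 0 ∨ b i ≠ 0) (τ : AinfTop.TatePtO F (W.map ψ) p) (hτ : τ ≠ 0) :
    ∑ i : Fin D.e, BdRPlusTop.of F p (embBdRHom hp hθ (D.root ^ (i : ℕ))) *
        (BdRPlusTop.of F p (qpToBdR (a i : ℚ_[p])) * P₀ τ + BdRPlusTop.of F p (qpToBdR (b i : ℚ_[p])) * Q₀ τ) ≠ 0 := by
  have hprime : p.Prime := Fact.out
  haveI := isDomain_bDeRhamPlus (F := F) (p := p) hθ
  obtain ⟨w, ⟨hw, hwv⟩, -⟩ := exists_unique_transport_seqO D W E₀ hWE ψ hψ τ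
  obtain ⟨z, hz⟩ := exists_witness_transport D W E₀ ψ τ hw hwv hN (hθ := hθ)
  -- `φ²Λ = −pΛ` (Honda with `a_p = 0`)
  have htr : HasseManin.tr (E₀.map (Int.castRingHom (ZMod p))) = 0 :=
    hasseManinTr_eq_zero_of_hasseCoeff_eq_zero hp5 _ hA
  have hofp : AdicCompletion.of (Ideal.span {(p : bmaxZero F p)}) (bmaxZero F p) (p : bmaxZero F p) = (p : BmaxPlus F p) :=
    map_natCast (algebraMap (bmaxZero F p) (BmaxPlus F p)) p
  have hR := frobBmaxPlus_hondaTrace_transport_eq_zero D W E₀ ψ (hθ := hθ) hN hLT τ hw hwv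
  rw [hofp, htr, Int.cast_zero, map_zero, map_zero, zero_mul, sub_zero] at hR
  have hφ2 : frobBmaxPlus F p (frobBmaxPlus F p (LT τ)) = -((p : BmaxPlus F p) * LT τ) := by linear_combination hR
  -- scalars under `φ` and `f`
  have hφc : ∀ c : ℤ_[p], frobBmaxPlus F p (ainfToBmaxPlus F p (zpToAinf c)) = ainfToBmaxPlus F p (zpToAinf c) := fun c => by
    rw [frobBmaxPlus_ainfToBmaxPlus, frobenius_zpToAinf]
  -- the elements `b′ᵢ = −aᵢφΛ + p bᵢΛ` with `φ b′ᵢ = p(aᵢΛ + bᵢφΛ)`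
  obtain ⟨b', hb'⟩ : ∃ b' : Fin D.e → BmaxPlus F p, ∀ i, b' i =
      -(ainfToBmaxPlus F p (zpToAinf (a i)) * frobBmaxPlus F p (LT τ)) + (p : BmaxPlus F p) * (ainfToBmaxPlus F p (zpToAinf (b i)) * LT τ) :=
    ⟨_, fun i => rfl⟩
  have hφb' : ∀ i, frobBmaxPlus F p (b' i) =
      (p : BmaxPlus F p) * (ainfToBmaxPlus F p (zpToAinf (a i)) * LT τ + ainfToBmaxPlus F p (zpToAinf (b i)) * frobBmaxPlus F p (LT τ)) := by
    intro i
    rw [hb', map_add, map_neg, map_mul, map_mul, map_mul, hφc, hφc, hφ2, map_natCast]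
    ring
  intro h0
  -- the relation handed to the named fact
  have hsum : (∑ i : Fin D.e, embBdRHom hp hθ (D.root ^ (i : ℕ)) * bmaxPlusToBdR F p (frobBmaxPlus F p (b' i))) = 0 := by
    have h1 : ∀ i : Fin D.e, embBdRHom hp hθ (D.root ^ (i : ℕ)) * bmaxPlusToBdR F p (frobBmaxPlus F p (b' i)) =
        (p : BDeRhamPlus (integerC F) p) * (BdRPlusTop.of F p).symm (BdRPlusTop.of F p (embBdRHom hp hθ (D.root ^ (i : ℕ))) *
          (BdRPlusTop.of F p (qpToBdR (a i : ℚ_[p])) * P₀ τ + BdRPlusTop.of F p (qpToBdR (b i : ℚ_[p])) * Q₀ τ)) := by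
      intro i
      rw [hφb', hP₀, hQ₀]
      simp only [map_mul, map_add, map_natCast, RingEquiv.symm_apply_apply, bmaxPlusToBdR_ainfToBmaxPlus_zpToAinf]
      ring
    rw [Finset.sum_congr rfl fun i _ => h1 i, ← Finset.mul_sum, ← map_sum, h0, map_zero, mul_zero]
  have hzero := hINJ hp hθ D b' hsum
  -- pick a nonzero coordinate pair
  obtain ⟨i, hi⟩ := hab
  have E1 : ainfToBmaxPlus F p (zpToAinf (a i)) * LT τ + ainfToBmaxPlus F p (zpToAinf (b i)) * frobBmaxPlus F p (LT τ) = 0 := by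
    have h := hzero i
    rw [hφb'] at h
    exact eq_zero_of_natCast_mul_eq_zero' hθ h
  have E2 : ainfToBmaxPlus F p (zpToAinf (a i)) * frobBmaxPlus F p (LT τ) -
      (p : BmaxPlus F p) * (ainfToBmaxPlus F p (zpToAinf (b i)) * LT τ) = 0 := by
    have h := congrArg (frobBmaxPlus F p) E1
    rw [map_add, map_mul, map_mul, hφc, hφc, hφ2, map_zero] at h
    linear_combination h
  have E3 : ainfToBmaxPlus F p (zpToAinf (a i ^ 2 + (p : ℤ_[p]) * b i ^ 2)) * LT τ = 0 := by
    rw [map_add, map_mul, map_pow, map_natCast, map_pow, map_add, map_mul, map_pow, map_natCast, map_pow]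
    linear_combination (ainfToBmaxPlus F p (zpToAinf (a i))) * E1 - (ainfToBmaxPlus F p (zpToAinf (b i))) * E2
  have hΛ0 : LT τ = 0 := eq_zero_of_zpToAinf_mul_eq_zero hθ (sq_add_prime_mul_sq_ne_zero (a i) (b i) hi) E3
  -- contradiction with non-degeneracy
  have h1 : thetaBmaxPlus F p (LT τ) = 0 := by rw [hΛ0, map_zero]
  have h2 : thetaBmaxPlus F p (frobBmaxPlus F p (LT τ)) = 0 := by rw [hΛ0, map_zero, map_zero]
  rw [hLT τ w hw hwv z hz] at h1 h2
  exact thetaBmaxPlus_frobBmaxPlus_logSum_transport_ne_zero D W E₀ ψ hψ (hθ := hθ) hp hp5 hΔ hA τ hτ hw hwv hN hz h1 h2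

end Transported

end Literature.NumberTheory.PAdicHodge
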